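import Literature.Geometry.Kaehler.BlowUpDefect
import HarnessLib

/-!
# Uniformly normal ball pieces of the blow-ups of a holomorphic chain

Federer's passage from weak to flat convergence of the blow-ups `D_r` of a rectifiable current to
its tangent cone [Federer1969, 4.3.16, via the compactness theorem 4.2.17] cuts the currents at a
good sphere: by the slicing inequality [Federer1969, 4.2.1], for each `r` there is a radius
`t ∈ (ρ₁, ρ₂)` at which the pieces `D_r ⌞ 𝐁(0,t)` and `[C] ⌞ 𝐁(0,t)` have boundary of mass bounded
INDEPENDENTLY of `r` (the blow-ups have uniformly bounded mass by Lelong's theorem, and they and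
`[C] ⌞ 𝐁(0,1)` are cycles on the unit ball, `BlowUpDefect.lean`). This file proves exactly that,
for a holomorphic `p`-chain `T` (`p = q + 1`), `b ∈ Ω`, and any holomorphic `p`-chain `C` on `V`:

* `exists_level_mass_slice_add_le` — **a common good level for two currents** (general currents
  on an open set of a finite-dimensional space): if `T₁, T₂` and `∂T₁, ∂T₂` are representable and
  `C_k (∫_{f⁻¹[a,b+1]} ‖Df‖ d‖T₁‖ + ∫_{f⁻¹[a,b+1]} ‖Df‖ d‖T₂‖) ≤ B < ∞`, then some level `σ ∈ (a, b)`
  has `𝐌⟨T₁, f, σ+⟩ + 𝐌⟨T₂, f, σ+⟩ ≤ (B + 1)/(b − a)` (the measurable majorants of the slice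
  masses of `CurrentsSlicing.lean` integrate to at most `B`);
* `Current.IsRepresentable.boundary_restrictSet_eq_neg_slice` — for a cycle `X`,
  `∂(X ⌞ {σ < f}) = −⟨X, f, σ+⟩`;
* `HolomorphicChain.exists_ball_restrictSet_boundary_mass_le` — **uniformly normal ball pieces**:
  for `0 < ρ₁ < ρ₂ < 1` there is `c < ∞` such that for all small `r > 0` some `t ∈ (ρ₁, ρ₂)` has
  `𝐌(∂(D_r ⌞ 𝐁(0,t))) + 𝐌(∂([C]⌞𝐁(0,1) ⌞ 𝐁(0,t))) ≤ c`;
  `restrictSet_blowUp_eq`, `restrictSet_toCurrentIn_unitBall_eq` identify the pieces with the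
  currents of integration over the cut-down data (so they are locally rectifiable with support in
  `𝐁̄(0,t)`).

Together with `BlowUpDefect.lean` this supplies the hypotheses side (`𝐍 ≤ c`, supports in a
fixed ball, rectifiability) of the compactness theorem
`Literature.Geometry.GeometricMeasureTheory.Federer1969_compactness_integralCurrents` for the
defect currents of King's theorem; the integrality of the pieces (rectifiability of their
boundaries, Federer's boundary rectifiability theorem 4.2.16 (2)) is not addressed here.

Theorems only; no new definitions, no named facts.

## References

* H. Federer, *Geometric Measure Theory*, Springer 1969, 4.2.1, 4.2.17, 4.3.16–4.3.18
  [Federer1969].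
* R. Harvey, *Holomorphic chains and their boundaries*, PSPUM XXX.1 (1977), §1.10, Thm. 1.31
  [Harvey1977].
-/

noncomputable section

open scoped Manifold Topology ENNReal NNReal InnerProductSpace ContDiff Distributions
open Set Filter MeasureTheory Metric Function Module TopologicalSpace

/-! ### A common good level for two currents -/

namespace Literature.Geometry.GeometricMeasureTheory

-- Nested operator-norm instances on (duals of) `E [⋀^Fin n]→L[ℝ] ℝ`.
set_option maxSynthPendingDepth 2

section GoodLevel

variable {E : Type*} [NormedAddCommGroup E] [NormedSpace ℝ E] [FiniteDimensional ℝ E]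
  [MeasurableSpace E] [BorelSpace E] {Ω : Opens E} {k : ℕ}

/-- **A common good level for two currents.** If `T₁, T₂` and their boundaries are representable,
`f` is smooth and `C_k ∫_{f⁻¹[a,b+1]} ‖Df‖ d‖T₁‖ + C_k ∫_{f⁻¹[a,b+1]} ‖Df‖ d‖T₂‖ ≤ B < ∞`, then some
level `σ ∈ (a,b)` has `𝐌⟨T₁, f, σ+⟩ + 𝐌⟨T₂, f, σ+⟩ ≤ (B + 1)/(b − a)` (the slicing inequality
`∫_a^b 𝐌⟨T, f, σ+⟩ dσ ≤ Lip(f) ‖T‖{a < f < b}`, through the measurable majorants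
`liminfₙ sliceWindow`). [cite: Federer1969, 4.2.1] -/
theorem exists_level_mass_slice_add_le {T₁ T₂ : Current Ω (k + 1)} (h₁ : T₁.IsRepresentable)
    (hd₁ : T₁.boundary.IsRepresentable) (h₂ : T₂.IsRepresentable)
    (hd₂ : T₂.boundary.IsRepresentable) {f : E → ℝ} (hf : ContDiff ℝ ∞ f) {a b : ℝ} (hab : a < b)
    {B : ℝ≥0∞} (hB : B ≠ ⊤)
    (hI : ENNReal.ofReal (sliceConst k) *
        ∫⁻ x in f ⁻¹' Icc a (b + 1), ‖fderiv ℝ f x‖ₑ ∂T₁.variation +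
      ENNReal.ofReal (sliceConst k) *
        ∫⁻ x in f ⁻¹' Icc a (b + 1), ‖fderiv ℝ f x‖ₑ ∂T₂.variation ≤ B) :
    ∃ σ ∈ Ioo a b, (h₁.slice hd₁ hf.continuous σ).mass + (h₂.slice hd₂ hf.continuous σ).mass ≤
      (B + 1) / ENNReal.ofReal (b - a) := by
  set g₁ : ℝ → ℝ≥0∞ := fun σ => liminf (fun n => sliceWindow T₁ f n σ) atTop with hg₁
  set g₂ : ℝ → ℝ≥0∞ := fun σ => liminf (fun n => sliceWindow T₂ f n σ) atTop with hg₂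
  have hm₁ : Measurable g₁ := Measurable.liminf fun n => measurable_sliceWindow h₁ hf n
  have hm₂ : Measurable g₂ := Measurable.liminf fun n => measurable_sliceWindow h₂ hf n
  have hint : ∫⁻ σ in Ioo a b, (g₁ σ + g₂ σ) ≤ B := by
    rw [lintegral_add_left hm₁]
    exact (add_le_add (h₁.lintegral_liminf_sliceWindow_le hf a b one_pos)
      (h₂.lintegral_liminf_sliceWindow_le hf a b one_pos)).trans hI
  set lam : ℝ≥0∞ := (B + 1) / ENNReal.ofReal (b - a) with hlam
  have hlen0 : ENNReal.ofReal (b - a) ≠ 0 := by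
    rw [ne_eq, ENNReal.ofReal_eq_zero, not_le]; linarith
  have hlen : lam * ENNReal.ofReal (b - a) = B + 1 := by
    rw [hlam, ENNReal.div_mul_cancel hlen0 ENNReal.ofReal_ne_top]
  -- some level has `g₁ + g₂ ≤ lam`
  have hex : ∃ σ ∈ Ioo a b, g₁ σ + g₂ σ ≤ lam := by
    by_contra hcon
    push Not at hcon
    have hge : ∫⁻ _ in Ioo a b, lam ≤ ∫⁻ σ in Ioo a b, (g₁ σ + g₂ σ) :=
      setLIntegral_mono (hm₁.add hm₂) fun σ hσ => (hcon σ hσ).le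
    rw [setLIntegral_const, Real.volume_Ioo, hlen] at hge
    have := hge.trans hint
    exact absurd this (by
      rw [not_le]
      exact ENNReal.lt_add_right hB one_ne_zero)
  obtain ⟨σ, hσ, hg⟩ := hex
  exact ⟨σ, hσ, (add_le_add (h₁.mass_slice_le_liminf hd₁ hf σ)
    (h₂.mass_slice_le_liminf hd₂ hf σ)).trans hg⟩

/-- Congruence of `T ⌞ A` along an equality of sets. [folklore] -/
private theorem Current.IsRepresentable.restrictSet_congr_set {m : ℕ} {T : Current Ω m}
    (hT : T.IsRepresentable) {A B : Set E} (hA : MeasurableSet A) (hB : MeasurableSet B)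
    (h : A = B) : hT.restrictSet A hA = hT.restrictSet B hB := by
  subst h; rfl

/-- Congruence of `T ⌞ A` along an equality of currents. [folklore] -/
private theorem Current.IsRepresentable.restrictSet_congr {m : ℕ} {S T : Current Ω m}
    (hS : S.IsRepresentable) (hT : T.IsRepresentable) (h : S = T) {A : Set E}
    (hA : MeasurableSet A) : hS.restrictSet A hA = hT.restrictSet A hA := by
  subst h; rfl

/-- **For a cycle `X`, `∂(X ⌞ {σ < f}) = −⟨X, f, σ+⟩`.** [cite: Federer1969, 4.2.1] -/
theorem Current.IsRepresentable.boundary_restrictSet_eq_neg_slice {X : Current Ω (k + 1)}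
    (hX : X.IsRepresentable) (hdX : X.boundary.IsRepresentable) (h0 : X.boundary = 0)
    {f : E → ℝ} (hf : Continuous f) (σ : ℝ) :
    (hX.restrictSet {x | σ < f x} (measurableSet_lt_of_continuous hf σ)).boundary =
      -hX.slice hdX hf σ := by
  rw [Current.IsRepresentable.slice, hdX.restrictSet_of_eq_zero h0, zero_sub, neg_neg]

end GoodLevel

end Literature.Geometry.GeometricMeasureTheory

namespace Literature.Geometry.Kaehler

open Literature.Geometry.GeometricMeasureTheory

-- Nested operator-norm instances on (duals of) `V [⋀^Fin n]→L[ℝ] ℝ`.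
set_option maxSynthPendingDepth 2

universe u

variable {V : Type u} [NormedAddCommGroup V] [InnerProductSpace ℂ V] [FiniteDimensional ℂ V]

namespace HolomorphicChain

variable [MeasurableSpace V] [BorelSpace V] {Ω : Opens V} {q : ℕ}

/-! ### The slicing function `x ↦ −‖x‖²` -/

omit [FiniteDimensional ℂ V] [MeasurableSpace V] [BorelSpace V] in
/-- `‖D(−‖·‖²)(x)‖ = 2‖x‖`. [folklore] -/
private theorem norm_fderiv_neg_norm_sq (x : V) :
    letI : InnerProductSpace ℝ V := InnerProductSpace.complexToReal
    ‖fderiv ℝ (fun y : V => -(‖y‖ ^ 2)) x‖ = 2 * ‖x‖ := by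
  letI : InnerProductSpace ℝ V := InnerProductSpace.complexToReal
  have hfun : (fun y : V => -(‖y‖ ^ 2)) = -(fun y : V => ‖y‖ ^ 2) := rfl
  rw [hfun, ((hasStrictFDerivAt_norm_sq x).hasFDerivAt.neg).fderiv, norm_neg, two_nsmul,
    ← two_smul ℝ, norm_smul, innerSL_apply_norm, Real.norm_two]

omit [InnerProductSpace ℂ V] [FiniteDimensional ℂ V] [MeasurableSpace V] [BorelSpace V] in
/-- The superlevel set `{σ < −‖x‖²}` is the ball of radius `√(−σ)`. [folklore] -/
private theorem setOf_lt_neg_norm_sq_eq_ball (σ : ℝ) :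
    {x : V | σ < -(‖x‖ ^ 2)} = ball (0 : V) (Real.sqrt (-σ)) := by
  ext x
  rw [mem_setOf_eq, mem_ball_zero_iff, Real.lt_sqrt (norm_nonneg _)]
  constructor <;> intro h <;> linarith

/-- `∫_{S} ‖D(−‖·‖²)‖ d‖X‖ ≤ 2 𝐌(X)` for a current `X` on the unit ball (its variation lives on the
ball, where `‖D(−‖·‖²)‖ ≤ 2`). [cite: Federer1969, 4.1.7] -/
private theorem lintegral_norm_fderiv_le_two_mul_mass {m : ℕ} (X : Current (unitBall V) m)
    (S : Set V) :
    letI : InnerProductSpace ℝ V := InnerProductSpace.complexToReal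
    ∫⁻ x in S, ‖fderiv ℝ (fun y : V => -(‖y‖ ^ 2)) x‖ₑ ∂X.variation ≤ ENNReal.ofReal 2 * X.mass := by
  letI : InnerProductSpace ℝ V := InnerProductSpace.complexToReal
  have hae : ∀ᵐ x ∂X.variation, x ∈ ((unitBall V : Opens V) : Set V) := by
    have h := X.variation_compl
    rw [measure_eq_zero_iff_ae_notMem] at h
    filter_upwards [h] with x hx
    exact not_notMem.1 hx
  calc ∫⁻ x in S, ‖fderiv ℝ (fun y : V => -(‖y‖ ^ 2)) x‖ₑ ∂X.variation
      ≤ ∫⁻ x, ‖fderiv ℝ (fun y : V => -(‖y‖ ^ 2)) x‖ₑ ∂X.variation := setLIntegral_le_lintegral _ _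
    _ ≤ ∫⁻ _, ENNReal.ofReal 2 ∂X.variation := by
        refine lintegral_mono_ae (hae.mono fun x hx => ?_)
        rw [← ofReal_norm, norm_fderiv_neg_norm_sq]
        have hx1 : ‖x‖ < 1 := mem_unitBall.1 hx
        exact ENNReal.ofReal_le_ofReal (by linarith)
    _ = ENNReal.ofReal 2 * X.variation univ := by rw [lintegral_const]
    _ ≤ ENNReal.ofReal 2 * X.mass := by gcongr; exact X.variation_le_mass _

/-! ### The pieces `D_r ⌞ 𝐁(0,t)` and `[C]⌞𝐁(0,1) ⌞ 𝐁(0,t)` -/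

/-- The blow-up `D_r` is representable by integration (`0 < r`, `B(b,r) ⊆ Ω`).
[cite: Federer1969, 4.1.28, 4.3.16] -/
theorem isRepresentable_blowUp (T : HolomorphicChain 𝓘(ℂ, V) Ω (q + 1)) {b : V} {r : ℝ}
    (hr : 0 < r) (hball : ball b r ⊆ (Ω : Set V)) : (T.blowUp b r).IsRepresentable := by
  letI : InnerProductSpace ℝ V := InnerProductSpace.complexToReal
  exact (T.isRectifiableData_blowUp (Harvey1977_isRectifiableData_toCurrent_holds V Ω (q + 1) T)
    hr hball).isRepresentable

/-- `[C] ⌞ 𝐁(0,1)` is representable by integration. [cite: Federer1969, 4.1.28] -/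
theorem isRepresentable_toCurrentIn_unitBall (C : HolomorphicChain 𝓘(ℂ, V) (⊤ : Opens V) (q + 1)) :
    (C.toCurrentIn (unitBall V)).IsRepresentable := by
  letI : InnerProductSpace ℝ V := InnerProductSpace.complexToReal
  rw [toCurrentIn_unitBall_eq_inter]
  exact C.isRectifiableData_carrier_inter_unitBall.isRepresentable

/-- **`D_r ⌞ 𝐁(0,t)` is the current of integration over the cut-down blow-up data.**
[cite: Federer1969, 4.1.7, 4.3.16] -/
theorem restrictSet_blowUp_eq (T : HolomorphicChain 𝓘(ℂ, V) Ω (q + 1)) {b : V} {r : ℝ}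
    (hr : 0 < r) (hball : ball b r ⊆ (Ω : Set V)) (t : ℝ) :
    (T.isRepresentable_blowUp hr hball).restrictSet (ball (0 : V) t) measurableSet_ball =
      currentOfIntegration (T.blowUpSet b r ∩ ball (0 : V) 1 ∩ ball (0 : V) t) (T.blowUpDensity b r)
        (T.blowUpFrame b r) := by
  letI : InnerProductSpace ℝ V := InnerProductSpace.complexToReal
  exact (T.isRectifiableData_blowUp (Harvey1977_isRectifiableData_toCurrent_holds V Ω (q + 1) T)
    hr hball).restrictSet_eq measurableSet_ball

/-- **`[C]⌞𝐁(0,1) ⌞ 𝐁(0,t)` is the current of integration over the cut-down data of `C`.**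
[cite: Federer1969, 4.1.7] -/
theorem restrictSet_toCurrentIn_unitBall_eq (C : HolomorphicChain 𝓘(ℂ, V) (⊤ : Opens V) (q + 1))
    (t : ℝ) :
    C.isRepresentable_toCurrentIn_unitBall.restrictSet (ball (0 : V) t) measurableSet_ball =
      currentOfIntegration (C.carrier ∩ ball (0 : V) 1 ∩ ball (0 : V) t) C.density
        C.orientationFrame := by
  letI : InnerProductSpace ℝ V := InnerProductSpace.complexToReal
  rw [C.isRepresentable_toCurrentIn_unitBall.restrictSet_congr
    C.isRectifiableData_carrier_inter_unitBall.isRepresentable C.toCurrentIn_unitBall_eq_inter]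
  exact C.isRectifiableData_carrier_inter_unitBall.restrictSet_eq measurableSet_ball

/-! ### Uniformly normal ball pieces -/

/-- **Uniformly normal ball pieces of the blow-ups** [Federer1969, 4.3.16 via 4.2.1]: for a
holomorphic `p`-chain `T` (`p = q + 1`), `b ∈ Ω`, any holomorphic `p`-chain `C` on `V` and radii
`0 < ρ₁ < ρ₂`, there is `c < ∞` such that for all small `r > 0` some `t ∈ (ρ₁, ρ₂)` satisfies
`𝐌(∂(D_r ⌞ 𝐁(0,t))) + 𝐌(∂([C]⌞𝐁(0,1) ⌞ 𝐁(0,t))) ≤ c` (the blow-ups and `[C]⌞𝐁(0,1)` are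
cycles of uniformly bounded mass on the unit ball; cut both at a common good sphere of the
slicing function `−‖x‖²`). [cite: Federer1969, 4.2.1, 4.3.16; Harvey1977, §1.10] -/
theorem exists_ball_restrictSet_boundary_mass_le (T : HolomorphicChain 𝓘(ℂ, V) Ω (q + 1))
    (C : HolomorphicChain 𝓘(ℂ, V) (⊤ : Opens V) (q + 1)) {b : V} (hb : b ∈ (Ω : Set V))
    {ρ₁ ρ₂ : ℝ} (h0 : 0 < ρ₁) (h12 : ρ₁ < ρ₂) :
    ∃ c : ℝ≥0∞, c ≠ ⊤ ∧ ∀ᶠ r in 𝓝[>] (0 : ℝ), ∃ t ∈ Ioo ρ₁ ρ₂,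
      ∃ (hD : (T.blowUp b r).IsRepresentable) (hC : (C.toCurrentIn (unitBall V)).IsRepresentable),
        (Current.boundary (hD.restrictSet (ball (0 : V) t) measurableSet_ball :
            Current (unitBall V) (2 * q + 1 + 1))).mass +
          (Current.boundary (hC.restrictSet (ball (0 : V) t) measurableSet_ball :
            Current (unitBall V) (2 * q + 1 + 1))).mass ≤ c := by
  letI : InnerProductSpace ℝ V := InnerProductSpace.complexToReal
  -- uniform mass bounds
  obtain ⟨R, hR, hRΩ⟩ := Metric.isOpen_iff.1 Ω.isOpen b hb
  obtain ⟨M₀, hM₀top, hM₀⟩ := T.exists_mass_blowUp_le' (r₀ := R / 2) (R₀ := R) (half_pos hR)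
    (half_lt_self hR) hRΩ
  set MC : ℝ≥0∞ := (C.toCurrentIn (unitBall V)).mass with hMC
  have hMCtop : MC ≠ ⊤ := C.mass_toCurrentIn_unitBall_ne_top
  -- the slicing function and the level interval
  set f : V → ℝ := fun y => -(‖y‖ ^ 2) with hfdef
  have hf : ContDiff ℝ ∞ f := (contDiff_norm_sq ℂ).neg
  set a : ℝ := -(ρ₂ ^ 2) with ha
  set b' : ℝ := -(ρ₁ ^ 2) with hb'
  have hab : a < b' := by rw [ha, hb']; nlinarith
  set B : ℝ≥0∞ := ENNReal.ofReal (sliceConst (2 * q + 1)) * (ENNReal.ofReal 2 * M₀) +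
    ENNReal.ofReal (sliceConst (2 * q + 1)) * (ENNReal.ofReal 2 * MC) with hB
  have hBtop : B ≠ ⊤ :=
    ENNReal.add_ne_top.2 ⟨ENNReal.mul_ne_top ENNReal.ofReal_ne_top
      (ENNReal.mul_ne_top ENNReal.ofReal_ne_top hM₀top),
      ENNReal.mul_ne_top ENNReal.ofReal_ne_top (ENNReal.mul_ne_top ENNReal.ofReal_ne_top hMCtop)⟩
  refine ⟨(B + 1) / ENNReal.ofReal (b' - a), ENNReal.div_ne_top (ENNReal.add_ne_top.2
    ⟨hBtop, ENNReal.one_ne_top⟩) (by rw [ne_eq, ENNReal.ofReal_eq_zero, not_le]; linarith), ?_⟩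
  filter_upwards [Ioo_mem_nhdsGT (half_pos hR)] with r hr
  have hballr : ball b r ⊆ (Ω : Set V) := (ball_subset_ball (by linarith [hr.2])).trans hRΩ
  -- the two cycles on the unit ball
  have hD : (T.blowUp b r).IsRepresentable := T.isRepresentable_blowUp hr.1 hballr
  have h0D : Current.boundary (T.blowUp b r : Current (unitBall V) (2 * q + 1 + 1)) = 0 :=
    T.boundary_blowUp_eq_zero' Harvey1977_isRectifiableData_toCurrent_holds
      Harvey1977_boundary_toCurrent_eq_zero_holds hr.1 hballr
  have hdD : (Current.boundary (T.blowUp b r : Current (unitBall V) (2 * q + 1 + 1))).IsRepresentable := by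
    rw [h0D]; exact Current.isRepresentable_zero
  have hC : (C.toCurrentIn (unitBall V)).IsRepresentable := C.isRepresentable_toCurrentIn_unitBall
  have h0C := C.boundary_toCurrentIn_unitBall_eq_zero
  have hdC : (Current.boundary (C.toCurrentIn (unitBall V) :
      Current (unitBall V) (2 * q + 1 + 1))).IsRepresentable := by
    rw [h0C]; exact Current.isRepresentable_zero
  -- the integrated slicing bound, uniformly in `r`
  have hI : ENNReal.ofReal (sliceConst (2 * q + 1)) *
        ∫⁻ x in f ⁻¹' Icc a (b' + 1), ‖fderiv ℝ f x‖ₑ ∂(T.blowUp b r).variation +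
      ENNReal.ofReal (sliceConst (2 * q + 1)) *
        ∫⁻ x in f ⁻¹' Icc a (b' + 1), ‖fderiv ℝ f x‖ₑ ∂(C.toCurrentIn (unitBall V)).variation ≤ B := by
    rw [hB]
    gcongr
    · exact (lintegral_norm_fderiv_le_two_mul_mass _ _).trans (by
        gcongr; exact hM₀ r hr.1 hr.2.le)
    · exact lintegral_norm_fderiv_le_two_mul_mass _ _
  obtain ⟨σ, hσ, hsum⟩ := exists_level_mass_slice_add_le (k := 2 * q + 1) hD hdD hC hdC hf hab
    hBtop hI
  -- the level `σ` is the sphere of radius `t = √(−σ)`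
  have hσ0 : σ < 0 := by
    have := hσ.2; rw [hb'] at this; nlinarith
  set t : ℝ := Real.sqrt (-σ) with ht
  have ht12 : t ∈ Ioo ρ₁ ρ₂ := by
    constructor
    · rw [ht, Real.lt_sqrt h0.le]; rw [hb'] at hσ; linarith [hσ.2]
    · rw [ht, Real.sqrt_lt' (h0.trans h12)]; rw [ha] at hσ; linarith [hσ.1]
  have hset : {x : V | σ < f x} = ball (0 : V) t := by
    rw [ht]; exact setOf_lt_neg_norm_sq_eq_ball σ
  refine ⟨t, ht12, hD, hC, ?_⟩
  rw [← hD.restrictSet_congr_set (measurableSet_lt_of_continuous hf.continuous σ) measurableSet_ball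
      hset, ← hC.restrictSet_congr_set (measurableSet_lt_of_continuous hf.continuous σ)
      measurableSet_ball hset, hD.boundary_restrictSet_eq_neg_slice hdD h0D hf.continuous σ,
    hC.boundary_restrictSet_eq_neg_slice hdC h0C hf.continuous σ, Current.mass_neg,
    Current.mass_neg]
  exact hsum

end HolomorphicChain

end Literature.Geometry.Kaehler
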